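import Summits.NavierStokesRegularity.NavierStokesRegularity.Theorems.QuietScarPocketDoorLZoomTopData
import Summits.NavierStokesRegularity.NavierStokesRegularity.Theorems.QuietScarPocketDoorZoomApexAE
import Summits.NavierStokesRegularity.NavierStokesRegularity.Theorems.QuietScarPocketDoorZoomOffApex
import Summits.NavierStokesRegularity.NavierStokesRegularity.Theorems.QuietScarPocketDoorLPocketDefs
import HarnessLib

/-!
# QuietScarPocketDoorLZoomTop — door S31 «QuietScarPocketDoor», §B «L-POCKET SCHEMA» (texts nsreg-p1 g25 `r29/Sketch31D.lean`
# 8bb56c0a84466268, tree `…QuietScarPocketDoorLPocketDefs`), plate (P1) PK1-L, file F4_L: THE TOP VELOCITY/GRADIENT TRACE OF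
# THE CLASS ZOOM OFF THE APEX (`TopGradTendsto`), its Type-I decay, scale-invariant gradient decay, incompressibility, and its
# annihilation by `L` on the pocket

The `∇`-twin of F4a (`exists_topCurl_of_classZoom`, `…ZoomTop`), for an arbitrary continuous linear constraint `L` on velocity
gradients.  Along the class zoom of F3_L — classical zooms `w k` on `Q(R_k,0)`, `R_k → ∞`, one-point bound, `𝐈 ≤ I`,
`‖L (∇w_k)(s,y)‖ ≤ ε_k` eventually as `s ↑ 0` on `B(e_k, κ)`, `e_k → e`, `ε_k → 0`, converging in `L³_loc` to a Type-I ancient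
mild `U` — the slices `U(s,·)` and their gradients converge as `s ↑ 0`, locally uniformly off the apex, to a velocity trace
`V₀` and its gradient (`TopGradTendsto U V₀`); `‖V₀ y‖ ≤ C_u/‖y‖`, `‖∇V₀ y‖ ≤ C′/‖y‖²`, `tr ∇V₀ = 0`, and `L(∇V₀) = 0` on
`B(e, κ)` (`exists_topGrad_of_classZoom`).

Proof = F4a's, run on values AND gradients: brick R (`exists_zoom_regularity`: k-uniform sup and joint Hölder bounds of
`w k`, `D_x w k` on off-apex top cylinders), brick L (`L³` ⇒ a.e. subsequence ⇒ everywhere by equi-Hölder + continuity of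
`U`; gradients from values by the uniform `D²` Taylor bound), so BOTH joint Hölder moduli pass to `U` up to the top
(`exists_limit_package₂`); s29-p2's `exists_terminalTraceC1` then gives the differentiable value trace with uniform convergence
of values and gradients on balls, identified with the global `V₀(x) := lim_{s↑0} U(s,x)`; the Type-I decay of `V₀` is the
everywhere one-point bound of `U` (F3b `ae_apex_of_classZoom` + F4b's `hasTypeIDecay_of_ae`); the SCALE-INVARIANT gradient
decay is Pineau–Vicol's quantitative Serrin bound `exists_forall_fderiv_le_of_bounded (C_u/3) I` on the cylinders
`Q((0,y₀), ‖y₀‖/4)` (velocity `≤ (C_u/3)/c`, ball-mean-gauged pressure mass `≤ c²·I` — brick R's data,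
`eventually_zoom_cylinder_data`, file `…LZoomTopData`), passed to `U` and to the trace; `tr ∇V₀ = lim tr ∇U(s,·) = 0`; and the pocket clause is F4a's
pocket argument with `‖L‖` in place of `‖curl‖`.

Width-seat file (prover ns-imp-p1 g4, first plate hand of the S-door lane, DIRECTOR-NS #209 (2) / #210 (3); planner of record
nsreg-p1 g25), `--supports stmt-NavierStokesRegularity-0056 --as helper`.  WHAT THIS IS NOT: a corollary schema of the S31
CRITERION about HYPOTHETICAL one-point Type-I blow-up; 0056 `NoTypeII` / NS regularity NOT proved.
-/

noncomputable section

set_option linter.dupNamespace false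

namespace Summit.NavierStokesRegularity.NavierStokesRegularity.Theorems.QuietScarPocketDoor

open MeasureTheory Set Function Filter Topology TopologicalSpace Metric
open scoped NNReal ENNReal Topology
open Literature.Analysis Literature.Analysis.FluidPDE
open Summit.NavierStokesRegularity.NavierStokesRegularity.Theorems.LocalIrrotationalScarDoorZoomTraceTools
  (tendsto_fderiv_of_tendsto_of_taylor)
open Summit.NavierStokesRegularity.NavierStokesRegularity.Theorems.LocalIrrotationalScarDoorZoomTopFading
  (taylor_bound_of_iteratedFDeriv_two)
open Summit.NavierStokesRegularity.NavierStokesRegularity.Theorems.LocalIrrotationalScarDoorZoomDataTop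
  (mem_parabolicCylinder_top_iff)

variable {F : Type*} [NormedAddCommGroup F] [NormedSpace ℝ F]

/-! ## The top velocity/gradient trace -/

/-- **Local uniform convergence of values and gradients of `U` at the top near `x₁ ≠ 0`** to the global value trace
`V₀(x) := lim_{s↑0} U(s,x)` and its gradient, from joint Hölder moduli of `U` and `D_x U` on the off-apex top cylinders
(s29-p2's `exists_terminalTraceC1` on the ball `B(x₁, ‖x₁‖/16)`, identified with the global `limUnder` trace by uniqueness of
limits; `D V₀ = D f` on the open ball). -/
theorem topGrad_trace_of_moduli {U : ℝ → EuclideanSpace ℝ (Fin 3) → EuclideanSpace ℝ (Fin 3)}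
    (hUd : ∀ s : ℝ, s < 0 → ∀ x : EuclideanSpace ℝ (Fin 3), DifferentiableAt ℝ (U s) x)
    {x₁ : EuclideanSpace ℝ (Fin 3)} (hx₁ : x₁ ≠ 0) {C α₀ α₁ : ℝ} (hα₀ : 0 < α₀) (hα₁ : 0 < α₁)
    (hH₀ : ∀ z ∈ parabolicCylinder (‖x₁‖ / 8) (((0 : ℝ), x₁) : ℝ × EuclideanSpace ℝ (Fin 3)),
        ∀ z' ∈ parabolicCylinder (‖x₁‖ / 8) (((0 : ℝ), x₁) : ℝ × EuclideanSpace ℝ (Fin 3)),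
          dist (U z.1 z.2) (U z'.1 z'.2) ≤ C * dist z z' ^ α₀)
    (hH₁ : ∀ z ∈ parabolicCylinder (‖x₁‖ / 16) (((0 : ℝ), x₁) : ℝ × EuclideanSpace ℝ (Fin 3)),
        ∀ z' ∈ parabolicCylinder (‖x₁‖ / 16) (((0 : ℝ), x₁) : ℝ × EuclideanSpace ℝ (Fin 3)),
          dist (fderiv ℝ (U z.1) z.2) (fderiv ℝ (U z'.1) z'.2) ≤ C * dist z z' ^ α₁) :
    TendstoUniformlyOn (fun s x => U s x) (fun x => limUnder (𝓝[<] (0 : ℝ)) (fun s => U s x)) (𝓝[<] (0 : ℝ))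
        (ball x₁ (‖x₁‖ / 16)) ∧
      TendstoUniformlyOn (fun s x => fderiv ℝ (U s) x)
        (fun x => fderiv ℝ (fun x' => limUnder (𝓝[<] (0 : ℝ)) (fun s => U s x')) x) (𝓝[<] (0 : ℝ))
        (ball x₁ (‖x₁‖ / 16)) := by
  have hn : 0 < ‖x₁‖ := norm_pos_iff.2 hx₁
  have hη : 0 < (‖x₁‖ / 16) ^ 2 := by positivity
  set S : Set (EuclideanSpace ℝ (Fin 3)) := ball x₁ (‖x₁‖ / 16) with hS
  have h16 := topCylinder_sixteenth_subset_eighth x₁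
  -- membership of the time lines
  have hmem : ∀ s ∈ Ioo (-(‖x₁‖ / 16) ^ 2) (0 : ℝ), ∀ x ∈ S, ((s, x) : ℝ × EuclideanSpace ℝ (Fin 3)) ∈
      parabolicCylinder (‖x₁‖ / 16) (((0 : ℝ), x₁) : ℝ × EuclideanSpace ℝ (Fin 3)) := fun s hs x hx => by
    rw [mem_parabolicCylinder_top_iff]; exact ⟨hs, mem_ball.1 hx⟩
  -- the two Hölder moduli in time on `S`
  have hT₀ : ∀ s ∈ Ioo (-(‖x₁‖ / 16) ^ 2) (0 : ℝ), ∀ t ∈ Ioo (-(‖x₁‖ / 16) ^ 2) (0 : ℝ), ∀ x ∈ S,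
      dist (U t x) (U s x) ≤ C * |t - s| ^ α₀ := by
    intro s hs t ht x hx
    have h := hH₀ (t, x) (h16 (hmem t ht x hx)) (s, x) (h16 (hmem s hs x hx))
    rwa [dist_time_pair] at h
  have hT₁ : ∀ s ∈ Ioo (-(‖x₁‖ / 16) ^ 2) (0 : ℝ), ∀ t ∈ Ioo (-(‖x₁‖ / 16) ^ 2) (0 : ℝ), ∀ x ∈ S,
      dist (fderiv ℝ (U t) x) (fderiv ℝ (U s) x) ≤ C * |t - s| ^ α₁ := by
    intro s hs t ht x hx
    have h := hH₁ (t, x) (hmem t ht x hx) (s, x) (hmem s hs x hx)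
    rwa [dist_time_pair] at h
  have hC0 := epsDelta_of_holder_time (F := fun s x => U s x) hη hα₀ hT₀
  have hC1 := epsDelta_of_holder_time (F := fun s x => fderiv ℝ (U s) x) hη hα₁ hT₁
  have hd : ∀ᶠ t in 𝓝[<] (0 : ℝ), DifferentiableOn ℝ (fun x => U t x) S := by
    filter_upwards [self_mem_nhdsWithin] with t ht
    exact fun x _ => (hUd t ht x).differentiableWithinAt
  obtain ⟨f, hfd, hf, hfg⟩ := exists_terminalTraceC1 (X := EuclideanSpace ℝ (Fin 3)) isOpen_ball hC0 hC1 hd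
  -- identification with the global `limUnder` trace
  have hEq : EqOn f (fun x => limUnder (𝓝[<] (0 : ℝ)) (fun s => U s x)) S := fun x hx =>
    ((hf.tendsto_at hx).limUnder_eq).symm
  have hEq' : ∀ x ∈ S, fderiv ℝ f x = fderiv ℝ (fun x' => limUnder (𝓝[<] (0 : ℝ)) (fun s => U s x')) x := by
    intro x hx
    refine Filter.EventuallyEq.fderiv_eq ?_
    filter_upwards [isOpen_ball.mem_nhds hx] with y hy using hEq hy
  exact ⟨hf.congr_right hEq, hfg.congr_right fun x hx => hEq' x hx⟩

/-- The trace map `A ↦ tr A` on `E³ →L[ℝ] E³`, as a continuous function. -/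
theorem continuous_trace_toLinearMap :
    Continuous fun A : EuclideanSpace ℝ (Fin 3) →L[ℝ] EuclideanSpace ℝ (Fin 3) =>
      LinearMap.trace ℝ (EuclideanSpace ℝ (Fin 3)) A.toLinearMap := by
  set τ : (EuclideanSpace ℝ (Fin 3) →L[ℝ] EuclideanSpace ℝ (Fin 3)) →ₗ[ℝ] ℝ :=
    (LinearMap.trace ℝ (EuclideanSpace ℝ (Fin 3))).comp (ContinuousLinearMap.coeLM ℝ) with hτ
  have h : Continuous τ := τ.continuous_of_finiteDimensional
  exact h

/-! ## F4_L -/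

set_option maxHeartbeats 800000 in
/-- **F4_L (TOP VELOCITY/GRADIENT TRACE + DECAY + INCOMPRESSIBILITY + POCKET)** for the class zoom of F3_L with constraint
`L`: `TopGradTendsto U V₀` for the value trace `V₀(x) := lim_{s↑0} U(s,x)`, `‖V₀ y‖ ≤ C_u/‖y‖`, `‖∇V₀ y‖ ≤ C′/‖y‖²`,
`tr ∇V₀ y = 0` off the apex, and `L (∇V₀ y) = 0` on `B(e, κ)`. -/
theorem exists_topGrad_of_classZoom (L : (EuclideanSpace ℝ (Fin 3) →L[ℝ] EuclideanSpace ℝ (Fin 3)) →L[ℝ] F)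
    {Cu κ : ℝ}
    {w : ℕ → ℝ → EuclideanSpace ℝ (Fin 3) → EuclideanSpace ℝ (Fin 3)} {π : ℕ → ℝ → EuclideanSpace ℝ (Fin 3) → ℝ}
    {Rk : ℕ → ℝ} {ek : ℕ → EuclideanSpace ℝ (Fin 3)} {εk : ℕ → ℝ} {I : ℝ≥0} {e : EuclideanSpace ℝ (Fin 3)}
    {U : ℝ → EuclideanSpace ℝ (Fin 3) → EuclideanSpace ℝ (Fin 3)}
    (hCu : 0 < Cu) (hκ1 : κ < 1) (hRk : Tendsto Rk atTop atTop)
    (hcl : ∀ k, IsClassicalNSSolutionOnRegion (parabolicCylinder (Rk k) (0 : ℝ × EuclideanSpace ℝ (Fin 3))) 1 0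
      (w k) (π k))
    (hone : ∀ k, ∀ z ∈ parabolicCylinder (Rk k) (0 : ℝ × EuclideanSpace ℝ (Fin 3)),
      ‖w k z.1 z.2‖ ≤ Cu / (Real.sqrt (-z.1) + ‖z.2‖))
    (hIk : ∀ k, typeIBound (parabolicCylinder (Rk k) (0 : ℝ × EuclideanSpace ℝ (Fin 3))) (w k) (π k)
      (fun t x => fderiv ℝ (w k t) x) ≤ I)
    (hek1 : ∀ k, ‖ek k‖ = 1) (hek : Tendsto ek atTop (𝓝 e)) (hε : Tendsto εk atTop (𝓝 0))
    (hpocket : ∀ k, ∀ y ∈ ball (ek k) κ, ∀ᶠ s in 𝓝[<] (0 : ℝ), ‖L (fderiv ℝ (w k s) y)‖ ≤ εk k)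
    (hU : IsTypeIAncientMild Cu U)
    (hL3 : ∀ r : ℝ, 0 < r → Tendsto (fun k => eLpNorm (uncurry (w k) - uncurry U) 3
      (volume.restrict (parabolicCylinder r (0 : ℝ × EuclideanSpace ℝ (Fin 3))))) atTop (𝓝 0)) :
    ∃ V₀ : EuclideanSpace ℝ (Fin 3) → EuclideanSpace ℝ (Fin 3),
      TopGradTendsto U V₀ ∧
      (∀ y : EuclideanSpace ℝ (Fin 3), y ≠ 0 → ‖V₀ y‖ ≤ Cu / ‖y‖) ∧
      (∃ C' : ℝ, ∀ y : EuclideanSpace ℝ (Fin 3), y ≠ 0 → ‖fderiv ℝ V₀ y‖ ≤ C' / ‖y‖ ^ 2) ∧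
      (∀ y : EuclideanSpace ℝ (Fin 3), y ≠ 0 →
        LinearMap.trace ℝ (EuclideanSpace ℝ (Fin 3)) (fderiv ℝ V₀ y).toLinearMap = 0) ∧
      (∀ y ∈ ball e κ, L (fderiv ℝ V₀ y) = 0) := by
  -- the limit: continuous on the open slab, smooth slices, divergence free, one-point bound everywhere
  have hUsm : ContDiffOn ℝ (⊤ : ℕ∞) (uncurry U) (Iio (0 : ℝ) ×ˢ univ) := hU.1
  have hUc : ContinuousOn (uncurry U) (Iio (0 : ℝ) ×ˢ univ) := hUsm.continuousOn
  have hslab_open : IsOpen (Iio (0 : ℝ) ×ˢ (univ : Set (EuclideanSpace ℝ (Fin 3)))) :=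
    isOpen_Iio.prod isOpen_univ
  have hUslice : ∀ s : ℝ, s < 0 → ContDiff ℝ (⊤ : ℕ∞) (U s) := by
    intro s hs
    rw [contDiff_iff_contDiffAt]
    intro x
    have h1 : ContDiffAt ℝ (⊤ : ℕ∞) (uncurry U) (s, x) :=
      hUsm.contDiffAt (hslab_open.mem_nhds ⟨hs, mem_univ _⟩)
    exact h1.comp x (contDiffAt_const.prodMk contDiffAt_id)
  have hUd : ∀ s : ℝ, s < 0 → ∀ x : EuclideanSpace ℝ (Fin 3), DifferentiableAt ℝ (U s) x :=
    fun s hs x => ((hUslice s hs).differentiable (by simp)).differentiableAt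
  have hapex := ae_apex_of_classZoom hRk hone hUc hL3
  have hdecay : HasTypeIDecay Cu U := hasTypeIDecay_of_ae hU hapex
  -- the trace
  set V₀ : EuclideanSpace ℝ (Fin 3) → EuclideanSpace ℝ (Fin 3) :=
    fun x => limUnder (𝓝[<] (0 : ℝ)) (fun s => U s x) with hV₀
  have hpack := fun (y₀ : EuclideanSpace ℝ (Fin 3)) (hy₀ : y₀ ≠ 0) =>
    exists_limit_package₂ hCu.le hRk hcl hone hIk hUc hUd hL3 hy₀
  have hunif : ∀ x₁ : EuclideanSpace ℝ (Fin 3), x₁ ≠ 0 →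
      TendstoUniformlyOn (fun s x => U s x) V₀ (𝓝[<] (0 : ℝ)) (ball x₁ (‖x₁‖ / 16)) ∧
      TendstoUniformlyOn (fun s x => fderiv ℝ (U s) x) (fun x => fderiv ℝ V₀ x) (𝓝[<] (0 : ℝ))
        (ball x₁ (‖x₁‖ / 16)) := by
    intro x₁ hx₁
    obtain ⟨C, α₀, α₁, hα₀, hα₁, -, φ, -, -, -, hH₀, -, hH₁⟩ := hpack x₁ hx₁
    exact topGrad_trace_of_moduli hUd hx₁ hα₀ hα₁ hH₀ hH₁
  -- pointwise versions at `y ≠ 0`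
  have hval_at : ∀ y : EuclideanSpace ℝ (Fin 3), y ≠ 0 → Tendsto (fun s => U s y) (𝓝[<] (0 : ℝ)) (𝓝 (V₀ y)) :=
    fun y hy => (hunif y hy).1.tendsto_at (mem_ball_self (by have := norm_pos_iff.2 hy; positivity))
  have hgrad_at : ∀ y : EuclideanSpace ℝ (Fin 3), y ≠ 0 →
      Tendsto (fun s => fderiv ℝ (U s) y) (𝓝[<] (0 : ℝ)) (𝓝 (fderiv ℝ V₀ y)) :=
    fun y hy => (hunif y hy).2.tendsto_at (mem_ball_self (by have := norm_pos_iff.2 hy; positivity))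
  refine ⟨V₀, ?_, ?_, ?_, ?_, ?_⟩
  · -- `TopGradTendsto U V₀`
    intro x₁ hx₁ θ hθ
    have hδ : 0 < ‖x₁‖ / 16 := by have := norm_pos_iff.2 hx₁; positivity
    obtain ⟨h0, h1⟩ := hunif x₁ hx₁
    have hev := ((Metric.tendstoUniformlyOn_iff.1 h0) θ hθ).and ((Metric.tendstoUniformlyOn_iff.1 h1) θ hθ)
    obtain ⟨s₀, hs₀, hs₀1, hwin⟩ := exists_window_of_eventually_nhdsLT hev
    refine ⟨s₀, ‖x₁‖ / 16, hs₀, hs₀1, hδ, fun s hs x hx => ⟨?_, ?_⟩⟩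
    · have h := (hwin s hs).1 x hx
      rw [dist_comm, dist_eq_norm] at h
      exact h.le
    · have h := (hwin s hs).2 x hx
      rw [dist_comm, dist_eq_norm] at h
      exact h.le
  · -- Type-I decay of the trace
    intro y hy
    have hyn : 0 < ‖y‖ := norm_pos_iff.2 hy
    refine le_of_tendsto (hval_at y hy).norm ?_
    filter_upwards [self_mem_nhdsWithin] with s hs
    calc ‖U s y‖ ≤ Cu / (‖y‖ + Real.sqrt (-s)) := hdecay s hs y
      _ ≤ Cu / ‖y‖ := div_le_div_of_nonneg_left hCu.le hyn (by linarith [Real.sqrt_nonneg (-s)])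
  · -- scale-invariant gradient decay of the trace
    obtain ⟨K, hK, hKev⟩ := exists_zoom_fderiv_bound hCu.le hRk hcl hone hIk
    refine ⟨16 * K, fun y hy => ?_⟩
    have hyn : 0 < ‖y‖ := norm_pos_iff.2 hy
    obtain ⟨C, α₀, α₁, -, -, -, φ, hφ, -, -, -, hgrad, -⟩ := hpack y hy
    have hφt : Tendsto φ atTop atTop := hφ.tendsto_atTop
    -- the bound for `D U(s, y)`, `s ∈ (−(‖y‖/16)², 0)`
    have hUs : ∀ s ∈ Ioo (-(‖y‖ / 16) ^ 2) (0 : ℝ), ‖fderiv ℝ (U s) y‖ ≤ 16 * K / ‖y‖ ^ 2 := by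
      intro s hs
      have hzs : ((s, y) : ℝ × EuclideanSpace ℝ (Fin 3)) ∈
          parabolicCylinder (‖y‖ / 16) (((0 : ℝ), y) : ℝ × EuclideanSpace ℝ (Fin 3)) := by
        rw [mem_parabolicCylinder_top_iff]; exact ⟨hs, by simpa using hyn⟩
      have h8s := topCylinder_sixteenth_subset_eighth y hzs
      have hconv := hgrad (s, y) hzs
      refine le_of_tendsto hconv.norm ?_
      filter_upwards [hφt.eventually (hKev y hy)] with j hj
      have h := hj (s, y) h8s
      have e : K / (‖y‖ / 4) ^ 2 = 16 * K / ‖y‖ ^ 2 := by field_simp; ring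
      rw [e] at h
      exact h
    refine le_of_tendsto (hgrad_at y hy).norm ?_
    filter_upwards [Ioo_mem_nhdsLT (show -(‖y‖ / 16) ^ 2 < (0 : ℝ) by
      have : 0 < (‖y‖ / 16) ^ 2 := by positivity
      linarith)] with s hs
    exact hUs s hs
  · -- incompressibility of the trace
    intro y hy
    have h1 : Tendsto (fun s => LinearMap.trace ℝ (EuclideanSpace ℝ (Fin 3)) (fderiv ℝ (U s) y).toLinearMap)
        (𝓝[<] (0 : ℝ)) (𝓝 (LinearMap.trace ℝ (EuclideanSpace ℝ (Fin 3)) (fderiv ℝ V₀ y).toLinearMap)) :=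
      (continuous_trace_toLinearMap.tendsto _).comp (hgrad_at y hy)
    have h2 : Tendsto (fun s => LinearMap.trace ℝ (EuclideanSpace ℝ (Fin 3)) (fderiv ℝ (U s) y).toLinearMap)
        (𝓝[<] (0 : ℝ)) (𝓝 0) := by
      refine tendsto_const_nhds.congr' ?_
      filter_upwards [self_mem_nhdsWithin] with s hs
      exact (hU.2.1 s hs y).symm
    exact tendsto_nhds_unique h1 h2
  · -- the pocket
    intro y hy
    have hy0 : y ≠ 0 := by
      intro h0
      rw [h0, mem_ball, dist_comm, dist_zero_right] at hy
      have he1 : ‖e‖ = 1 :=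
        tendsto_nhds_unique hek.norm (by simp [hek1] : Tendsto (fun k => ‖ek k‖) atTop (𝓝 1))
      linarith
    have hyn : 0 < ‖y‖ := norm_pos_iff.2 hy0
    obtain ⟨C, α₀, α, -, hα, hC, φ, hφ, hHk, -, -, hgrad, -⟩ := hpack y hy0
    have hφt : Tendsto φ atTop atTop := hφ.tendsto_atTop
    have hyk : ∀ᶠ k in atTop, y ∈ ball (ek k) κ := by
      have hlt : dist y e < κ := mem_ball.1 hy
      have h1 : Tendsto (fun k => dist y (ek k)) atTop (𝓝 (dist y e)) := tendsto_const_nhds.dist hek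
      filter_upwards [h1 (Iio_mem_nhds hlt)] with k hk
      exact mem_ball.2 hk
    have hkey : ∀ s ∈ Ioo (-(‖y‖ / 16) ^ 2) (0 : ℝ), ‖L (fderiv ℝ (U s) y)‖ ≤ ‖L‖ * C * (-s) ^ α := by
      intro s hs
      have hzs : ((s, y) : ℝ × EuclideanSpace ℝ (Fin 3)) ∈
          parabolicCylinder (‖y‖ / 16) (((0 : ℝ), y) : ℝ × EuclideanSpace ℝ (Fin 3)) := by
        rw [mem_parabolicCylinder_top_iff]; exact ⟨hs, by simpa using hyn⟩
      have hzoom : ∀ᶠ k in atTop, ‖L (fderiv ℝ (w k s) y)‖ ≤ ‖L‖ * C * (-s) ^ α + εk k := by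
        filter_upwards [hHk, hyk] with k hk hyk'
        obtain ⟨s₁, hs₁, -, hwin⟩ := exists_window_of_eventually_nhdsLT (hpocket k y hyk')
        set s' : ℝ := max s s₁ / 2 with hs'_def
        have hms : max s s₁ < 0 := max_lt hs.2 hs₁
        have hs'1 : max s s₁ < s' := by rw [hs'_def]; linarith
        have hs'0 : s' < 0 := by rw [hs'_def]; linarith
        have hss' : s < s' := (le_max_left _ _).trans_lt hs'1
        have hs₁s' : s₁ < s' := (le_max_right _ _).trans_lt hs'1
        have hq : ‖L (fderiv ℝ (w k s') y)‖ ≤ εk k := hwin s' ⟨hs₁s', hs'0⟩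
        have h8s : ((s, y) : ℝ × EuclideanSpace ℝ (Fin 3)) ∈
            parabolicCylinder (‖y‖ / 8) (((0 : ℝ), y) : ℝ × EuclideanSpace ℝ (Fin 3)) :=
          topCylinder_sixteenth_subset_eighth y hzs
        have h8s' : ((s', y) : ℝ × EuclideanSpace ℝ (Fin 3)) ∈
            parabolicCylinder (‖y‖ / 8) (((0 : ℝ), y) : ℝ × EuclideanSpace ℝ (Fin 3)) := by
          rw [mem_parabolicCylinder_top_iff] at h8s ⊢
          exact ⟨⟨by linarith [h8s.1.1], hs'0⟩, h8s.2⟩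
        have hmod := hk (s, y) h8s (s', y) h8s'
        rw [dist_time_pair] at hmod
        have habs : |s - s'| ≤ -s := by rw [abs_sub_comm, abs_of_pos (by linarith)]; linarith
        have hrpow : |s - s'| ^ α ≤ (-s) ^ α := Real.rpow_le_rpow (abs_nonneg _) habs hα.le
        have hLip : ‖L (fderiv ℝ (w k s) y) - L (fderiv ℝ (w k s') y)‖ ≤
            ‖L‖ * dist (fderiv ℝ (w k s) y) (fderiv ℝ (w k s') y) := by
          rw [← map_sub, dist_eq_norm]; exact L.le_opNorm _
        calc ‖L (fderiv ℝ (w k s) y)‖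
            ≤ ‖L (fderiv ℝ (w k s) y) - L (fderiv ℝ (w k s') y)‖ + ‖L (fderiv ℝ (w k s') y)‖ :=
              norm_le_norm_sub_add _ _
          _ ≤ ‖L‖ * dist (fderiv ℝ (w k s) y) (fderiv ℝ (w k s') y) + εk k := add_le_add hLip hq
          _ ≤ ‖L‖ * (C * |s - s'| ^ α) + εk k := by gcongr
          _ ≤ ‖L‖ * (C * (-s) ^ α) + εk k := by gcongr
          _ = ‖L‖ * C * (-s) ^ α + εk k := by ring
      have hconv : Tendsto (fun j => L (fderiv ℝ (w (φ j) s) y)) atTop (𝓝 (L (fderiv ℝ (U s) y))) :=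
        (L.continuous.tendsto _).comp (hgrad (s, y) hzs)
      have hrhs : Tendsto (fun j => ‖L‖ * C * (-s) ^ α + εk (φ j)) atTop (𝓝 (‖L‖ * C * (-s) ^ α + 0)) :=
        tendsto_const_nhds.add (hε.comp hφt)
      rw [add_zero] at hrhs
      exact le_of_tendsto_of_tendsto hconv.norm hrhs (hφt.eventually hzoom)
    have hlim0 : Tendsto (fun s : ℝ => ‖L‖ * C * (-s) ^ α) (𝓝[<] (0 : ℝ)) (𝓝 0) := by
      have h1 : Tendsto (fun s : ℝ => (-s) ^ α) (𝓝 (0 : ℝ)) (𝓝 ((-0 : ℝ) ^ α)) :=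
        ((Real.continuous_rpow_const hα.le).comp continuous_neg).tendsto 0
      rw [neg_zero, Real.zero_rpow hα.ne'] at h1
      simpa using (h1.const_mul (‖L‖ * C)).mono_left nhdsWithin_le_nhds
    have hev0 : ∀ᶠ s in 𝓝[<] (0 : ℝ), ‖L (fderiv ℝ (U s) y)‖ ≤ ‖L‖ * C * (-s) ^ α := by
      filter_upwards [Ioo_mem_nhdsLT (show -(‖y‖ / 16) ^ 2 < (0 : ℝ) by
        have : 0 < (‖y‖ / 16) ^ 2 := by positivity
        linarith)] with s hs
      exact hkey s hs
    have hLconv : Tendsto (fun s => L (fderiv ℝ (U s) y)) (𝓝[<] (0 : ℝ)) (𝓝 (L (fderiv ℝ V₀ y))) :=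
      (L.continuous.tendsto _).comp (hgrad_at y hy0)
    have h0 : ‖L (fderiv ℝ V₀ y)‖ ≤ 0 := le_of_tendsto_of_tendsto hLconv.norm hlim0 hev0
    exact norm_le_zero_iff.1 h0

end Summit.NavierStokesRegularity.NavierStokesRegularity.Theorems.QuietScarPocketDoor

end
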